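import Literature.MathematicalPhysics.QuantumFieldTheory.QCDPhaseQuenchedReweighting
import Summits.QuantumFields.QCD.Theorems.QuarksNoInfraredClauseTorusHalfSpectrumStubSelectionRule
import HarnessLib

/-!
# Crux `TorusHalfSpectrum` (stmt-QuantumFields-9508), line `registered` (`Lines/birth.lean`, reshape v3) —
# stub `stub_conjugate_heavy`: the heavy-mass corner of the half-spectrum lemma

Stub H of the birth skeleton of the crux
`Summit.QuantumFields.QCD.Theses.QuarksNoInfraredClause.TorusHalfSpectrum` (= `HeavyStmt` unfolded):
GIVEN determinant positivity (stub D, `stub_det_diracMatrix_pos`: `0 < Re det D(U)` for positive bare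
masses) and the configuration-wise hopping bound for conjugate charged pairs (stub P,
`stub_conjugate_heavy_pathwise`: `‖∫dψ̄dψ A(0)B(n e₀)e^{-ψ̄D(U)ψ}‖ ≤ K θⁿ ‖∫dψ̄dψ e^{-ψ̄D(U)ψ}‖`,
`θ = 4/(m₀+4)`, on tori `2S+1 > 2(R+R')+1`, masses `≥ m₀`, `n ≤ S`) — both taken as HYPOTHESES — every
conjugate charged pair (`A` homogeneous of charge `q ≠ 0`, `B` of charge `-q`) clusters at EVERY rate
`Δ > 0` along every scheme in the heavy-mass corner `m_f(k) ≥ m₀ > 0` eventually, in the quantifier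
shape of `QCDScheme.HasLatticeMassGap`.

Proof.
* `⟨A⟩ = 0` by the exact flavour selection rule (`SelectionRule.qcdTorusExpect_onTorus_eq_zero`, `q ≠ 0`),
  so the connected correlator is the honest ratio `∫_U num(U) dμ_W / ∫_U den(U) dμ_W`,
  `num(U) = ∫dψ̄dψ A(0)B(n e₀)e^{-ψ̄D(U)ψ}`, `den(U) = ∫dψ̄dψ e^{-ψ̄D(U)ψ}` (`qcdTorusExpect`).
* CONSTANT PHASE of the denominator: `den(U) = ε det D(U)` with the `U`-independent orientation sign
  `ε = (-1)^{N(N-1)/2+N}` (`fermiIntegral_fermiBoltzmann`, the Gaussian Berezin formula), and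
  `det D(U) = Re det D(U) > 0` (reality `det_diracMatrix_eq_ofReal_re` + stub D); hence
  `∫_U ‖den(U)‖ dμ_W = ∫_U Re det D(U) dμ_W = ‖∫_U den(U) dμ_W‖` (`integral_const_mul`,
  `integral_complex_ofReal`), and `‖∫ num‖ ≤ ∫ ‖num‖ ≤ K θⁿ ∫ ‖den‖ = K θⁿ ‖∫ den‖`
  (`norm_integral_le_of_norm_le`; integrability from `integrable_norm_det_diracMatrix`, the Wilson measure
  being a probability measure on the compact configuration space).  So `‖corr‖ ≤ max K 0 · θⁿ`
  (`norm_qcdLatticeConnectedCorr_le_of_pathwise`).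
* Rates: `θⁿ = e^{n log θ} ≤ e^{-Δ a_k n}` as soon as `Δ a_k ≤ -log θ` (`0 < θ < 1`, `a_k → 0`,
  `sch.tendsto_a`), and the side condition `R + R' < S` holds for all `S ≥ L_k` eventually
  (`a_k L_k → ∞`, `sch.tendsto_L`, with `a_k ≤ 1` eventually); the mass condition `m_f(k) ≥ m₀` for all
  flavours eventually is `Filter.eventually_all` (finitely many flavours).

Everything used is proved in the tree (no named fact).  Sources: I. Montvay, G. Münster, *Quantum Fields on
a Lattice* (CUP 1994), §4.1 (4.17) (Gaussian Grassmann integral), §5.1.2 (5.16) (real quark determinant),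
§5.1.1 (5.6) (flavour symmetry); K. Osterwalder, E. Seiler, Ann. Phys. 110 (1978) 440, §2.
-/

noncomputable section

namespace Summit.QuantumFields.QCD.Cruxes.TorusHalfSpectrum.Birth.ConjugateHeavy

open scoped BigOperators Topology
open Filter MeasureTheory Literature.MathematicalPhysics.QuantumFieldTheory
  Literature.MathematicalPhysics.QuantumLattice
open Summit.QuantumFields.QCD.Cruxes.TorusHalfSpectrum.Birth.SelectionRule (qcdTorusExpect_onTorus_eq_zero)

variable {Nf : ℕ}

/-! ### From a configuration-wise bound to a bound on the honest ratio -/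

/-- **Constant phase turns a pathwise bound into a bound on the connected correlator.**  On the torus of
side `T`, if `Re det D(U) > 0` for every gauge field `U` (bare masses `mq`), `A` is homogeneous of non-zero
charge `q` (so `⟨A⟩ = 0`), and the fermionic integral of `A(0)B(n e₀)` is bounded configuration-wise by
`M ‖∫dψ̄dψ e^{-ψ̄D(U)ψ}‖` with `M ≥ 0`, then `‖⟨A(0)B(n e₀)⟩ − ⟨A⟩⟨B⟩‖ ≤ M`: the denominator
`∫_U ∫dψ̄dψ e^{-ψ̄D(U)ψ} dμ_W = ε ∫_U Re det D(U) dμ_W` has modulus `∫_U ‖∫dψ̄dψ e^{-ψ̄D(U)ψ}‖ dμ_W`. -/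
theorem norm_qcdLatticeConnectedCorr_le_of_pathwise {R R' T : ℕ} [NeZero T]
    (A : QCDLatticeObservable Nf R) (B : QCDLatticeObservable Nf R') {q : Fin Nf → ℤ} (hq : q ≠ 0)
    (hA : ∀ t : Fin Nf → ℂ, (∀ f, t f ≠ 0) → ∀ U,
      QCDLatticeObservable.flavourScale t (A.F U) = (∏ f, t f ^ (q f)) • A.F U)
    (β : ℝ) (mq : Fin Nf → ℝ)
    (hpos : ∀ U : GaugeConfig 4 T (Matrix.specialUnitaryGroup (Fin 3) ℂ), 0 < ((diracMatrix U mq).det).re)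
    (n : ℕ) {M : ℝ} (hM : 0 ≤ M)
    (hpt : ∀ U : GaugeConfig 4 T (Matrix.specialUnitaryGroup (Fin 3) ℂ),
      ‖fermiIntegral (A.onTorus T 0 U * B.onTorus T (Pi.single 0 (n : ℤ)) U * fermiBoltzmann U mq)‖ ≤
        M * ‖fermiIntegral (fermiBoltzmann U mq)‖) :
    ‖qcdLatticeConnectedCorr β T mq A B n‖ ≤ M := by
  rw [qcdLatticeConnectedCorr, qcdTorusExpect_onTorus_eq_zero A hq hA β mq 0, zero_mul, sub_zero,
    qcdTorusExpect, norm_div]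
  set μ := wilsonMeasure (d := 4) (L := T) (fundamentalRep (Fin 3)) β with hμ
  -- the modulus of the fermionic partition function in the background `U` is `Re det D(U)`
  have hnormfB : ∀ U : GaugeConfig 4 T (Matrix.specialUnitaryGroup (Fin 3) ℂ),
      ‖fermiIntegral (fermiBoltzmann U mq)‖ = (diracMatrix U mq).det.re := fun U => by
    rw [fermiIntegral_fermiBoltzmann, norm_mul, norm_pow, norm_neg, norm_one, one_pow, one_mul,
      norm_det_diracMatrix_eq_abs_re, abs_of_pos (hpos U)]
  -- constant phase: the modulus of the denominator is the integral of the modulus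
  have hden : ‖∫ U, fermiIntegral (fermiBoltzmann U mq) ∂μ‖ = ∫ U, (diracMatrix U mq).det.re ∂μ := by
    have hfun : (fun U : GaugeConfig 4 T (Matrix.specialUnitaryGroup (Fin 3) ℂ) =>
        fermiIntegral (fermiBoltzmann U mq)) = fun U =>
        (-1 : ℂ) ^ (Fintype.card (FermiIdx Nf T) * (Fintype.card (FermiIdx Nf T) - 1) / 2 +
          Fintype.card (FermiIdx Nf T)) * (((diracMatrix U mq).det.re : ℝ) : ℂ) := by
      funext U
      rw [fermiIntegral_fermiBoltzmann, ← det_diracMatrix_eq_ofReal_re]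
    rw [hfun, integral_const_mul, integral_complex_ofReal, norm_mul, norm_pow, norm_neg, norm_one,
      one_pow, one_mul, Complex.norm_real, Real.norm_eq_abs,
      abs_of_nonneg (integral_nonneg fun U => (hpos U).le)]
  -- integrability of `U ↦ Re det D(U)` (continuous on a compact space, finite measure)
  have hint : Integrable (fun U : GaugeConfig 4 T (Matrix.specialUnitaryGroup (Fin 3) ℂ) =>
      (diracMatrix U mq).det.re) μ := by
    refine (integrable_norm_det_diracMatrix mq μ).congr (Eventually.of_forall fun U => ?_)
    beta_reduce
    rw [norm_det_diracMatrix_eq_abs_re, abs_of_pos (hpos U)]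
  -- the numerator
  have hnum : ‖∫ U, fermiIntegral (A.onTorus T 0 U * B.onTorus T (Pi.single 0 (n : ℤ)) U *
      fermiBoltzmann U mq) ∂μ‖ ≤ M * ∫ U, (diracMatrix U mq).det.re ∂μ := by
    rw [← integral_const_mul]
    refine norm_integral_le_of_norm_le (hint.const_mul M) (Eventually.of_forall fun U => ?_)
    rw [← hnormfB]
    exact hpt U
  rw [hden]
  exact div_le_of_le_mul₀ (integral_nonneg fun U => (hpos U).le) hM hnum

/-! ### The registered stub -/

/-- **Stub `stub_conjugate_heavy` of the birth skeleton of `TorusHalfSpectrum` (= `HeavyStmt` unfolded):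
the heavy-mass corner.**  Given determinant positivity for positive bare masses (stub D) and the
configuration-wise hopping bound for conjugate charged pairs (stub P), both as hypotheses: along every
scheme whose bare masses are eventually all `≥ m₀ > 0`, every conjugate charged pair (`A` homogeneous of
charge `q ≠ 0`, `B` of charge `-q`) clusters at every rate `Δ > 0` in the quantifier shape of
`QCDScheme.HasLatticeMassGap`.  `⟨A⟩ = 0` (selection rule), constant phase of `∫dψ̄dψ e^{-ψ̄D(U)ψ}` in `U`
(`norm_qcdLatticeConnectedCorr_le_of_pathwise`) gives `‖corr‖ ≤ max K 0 · θⁿ`, `θ = 4/(m₀+4) < 1`; then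
`θⁿ ≤ e^{-Δ a_k n}` once `Δ a_k ≤ -log θ` (`a_k → 0`), and `R + R' < L_k ≤ S` eventually (`a_k L_k → ∞`). -/
theorem stub_conjugate_heavy :
    (∀ (Nf S : ℕ) [NeZero S] (U : GaugeConfig 4 S (Matrix.specialUnitaryGroup (Fin 3) ℂ))
        (mq : Fin Nf → ℝ), (∀ f, 0 < mq f) → 0 < ((diracMatrix U mq).det).re) →
    (∀ (Nf R R' : ℕ) (A : QCDLatticeObservable Nf R) (B : QCDLatticeObservable Nf R') (q : Fin Nf → ℤ)
        (m₀ : ℝ), 0 < m₀ →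
        (∀ t : Fin Nf → ℂ, (∀ f, t f ≠ 0) → ∀ U,
            QCDLatticeObservable.flavourScale t (A.F U) = (∏ f, t f ^ (q f)) • A.F U) →
        (∀ t : Fin Nf → ℂ, (∀ f, t f ≠ 0) → ∀ U,
            QCDLatticeObservable.flavourScale t (B.F U) = (∏ f, t f ^ ((-q) f)) • B.F U) →
        q ≠ 0 →
          ∃ K : ℝ, ∀ (S : ℕ), R + R' < S → ∀ (mq : Fin Nf → ℝ), (∀ f, m₀ ≤ mq f) →
            ∀ (U : GaugeConfig 4 (2 * S + 1) (Matrix.specialUnitaryGroup (Fin 3) ℂ)) (n : ℕ), n ≤ S →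
              ‖fermiIntegral (A.onTorus (2 * S + 1) 0 U * B.onTorus (2 * S + 1) (Pi.single 0 (n : ℤ)) U *
                  fermiBoltzmann U mq)‖ ≤
                K * (4 / (m₀ + 4)) ^ n * ‖fermiIntegral (fermiBoltzmann U mq)‖) →
    ∀ (Nf : ℕ) (sch : QCDScheme Nf) (Δ : ℝ), 0 < Δ →
      (∃ m₀ : ℝ, 0 < m₀ ∧ ∀ fl : Fin Nf, ∀ᶠ k in atTop, m₀ ≤ sch.mq fl k) →
        ∀ (R R' : ℕ) (A : QCDLatticeObservable Nf R) (B : QCDLatticeObservable Nf R')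
          (q : Fin Nf → ℤ),
          (∀ t : Fin Nf → ℂ, (∀ f, t f ≠ 0) → ∀ U,
              QCDLatticeObservable.flavourScale t (A.F U) = (∏ f, t f ^ (q f)) • A.F U) →
          (∀ t : Fin Nf → ℂ, (∀ f, t f ≠ 0) → ∀ U,
              QCDLatticeObservable.flavourScale t (B.F U) = (∏ f, t f ^ ((-q) f)) • B.F U) →
          q ≠ 0 →
            ∃ C : ℝ, ∀ᶠ k in atTop, ∀ S : ℕ, sch.L k ≤ S → ∀ n : ℕ, n ≤ S →
              ‖qcdLatticeConnectedCorr (sch.β k) (2 * S + 1) (fun fl => sch.mq fl k) A B n‖ ≤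
                C * Real.exp (-(Δ * (sch.a k * n))) := by
  rintro hdet hpath Nf sch Δ _hΔ ⟨m₀, hm₀, hmass⟩ R R' A B q hA hB hq
  obtain ⟨K, hK⟩ := hpath Nf R R' A B q m₀ hm₀ hA hB hq
  -- the hopping ratio `θ = 4/(m₀+4) ∈ (0, 1)`
  set θ : ℝ := 4 / (m₀ + 4) with hθ_def
  have hθpos : 0 < θ := by positivity
  have hθlt : θ < 1 := (div_lt_one (by positivity)).2 (by linarith)
  have hlog : 0 < -Real.log θ := neg_pos.2 (Real.log_neg hθpos hθlt)
  -- (i) all bare masses are `≥ m₀` eventually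
  have h1 : ∀ᶠ k in atTop, ∀ fl, m₀ ≤ sch.mq fl k := eventually_all.2 hmass
  -- (ii) the rate condition `Δ a_k ≤ -log θ` eventually (`a_k → 0`)
  have h2 : ∀ᶠ k in atTop, Δ * sch.a k ≤ -Real.log θ := by
    have ht : Tendsto (fun k => Δ * sch.a k) atTop (𝓝 0) := by
      simpa using sch.tendsto_a.const_mul Δ
    exact ht.eventually_le_const hlog
  -- (iii) the boxes fit: `R + R' < L_k` eventually (`a_k L_k → ∞`, `a_k ≤ 1` eventually)
  have h3 : ∀ᶠ k in atTop, R + R' < sch.L k := by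
    have ha1 : ∀ᶠ k in atTop, sch.a k ≤ 1 := sch.tendsto_a.eventually_le_const one_pos
    have hL : ∀ᶠ k in atTop, ((R + R' + 1 : ℕ) : ℝ) ≤ sch.a k * sch.L k :=
      tendsto_atTop.1 sch.tendsto_L _
    filter_upwards [ha1, hL] with k hk hk'
    have hle : ((R + R' + 1 : ℕ) : ℝ) ≤ (sch.L k : ℝ) :=
      hk'.trans (mul_le_of_le_one_left (Nat.cast_nonneg _) hk)
    exact Nat.lt_iff_add_one_le.2 (Nat.cast_le.1 hle)
  refine ⟨max K 0, ?_⟩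
  filter_upwards [h1, h2, h3] with k hk1 hk2 hk3 S hS n hn
  have hS' : R + R' < S := lt_of_lt_of_le hk3 hS
  have hmpos : ∀ f, 0 < sch.mq f k := fun f => hm₀.trans_le (hk1 f)
  have hθn : 0 ≤ θ ^ n := pow_nonneg hθpos.le n
  -- the pathwise bound on this torus, upgraded to a bound on the honest ratio
  have hbound : ‖qcdLatticeConnectedCorr (sch.β k) (2 * S + 1) (fun fl => sch.mq fl k) A B n‖ ≤
      max K 0 * θ ^ n := by
    refine norm_qcdLatticeConnectedCorr_le_of_pathwise A B hq hA (sch.β k) (fun fl => sch.mq fl k)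
      (fun U => hdet Nf (2 * S + 1) U (fun fl => sch.mq fl k) hmpos) n
      (mul_nonneg (le_max_right _ _) hθn) fun U => ?_
    exact (hK S hS' (fun fl => sch.mq fl k) hk1 U n hn).trans
      (mul_le_mul_of_nonneg_right (mul_le_mul_of_nonneg_right (le_max_left K 0) hθn) (norm_nonneg _))
  refine hbound.trans (mul_le_mul_of_nonneg_left ?_ (le_max_right _ _))
  -- rates: `θⁿ ≤ e^{-Δ a_k n}`
  have hrate : Real.log θ ≤ -(Δ * sch.a k) := by linarith
  calc θ ^ n = Real.exp (n * Real.log θ) := by rw [Real.exp_nat_mul, Real.exp_log hθpos]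
    _ ≤ Real.exp (-(Δ * (sch.a k * n))) := Real.exp_le_exp.2 (by
        calc (n : ℝ) * Real.log θ ≤ n * (-(Δ * sch.a k)) :=
              mul_le_mul_of_nonneg_left hrate (Nat.cast_nonneg n)
          _ = -(Δ * (sch.a k * n)) := by ring)

end Summit.QuantumFields.QCD.Cruxes.TorusHalfSpectrum.Birth.ConjugateHeavy

end
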